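import Literature.AlgebraicGeometry.Motives.WeilTypeCMProofs
import Literature.AlgebraicGeometry.Motives.WeilTypePolarization
import Literature.AlgebraicGeometry.Motives.HodgeStructureEndomorphismFieldCharpoly
import Literature.NumberTheory.NumberFields.TraceFormTotallyReal
import Mathlib.LinearAlgebra.BilinearForm.Orthogonal
import HarnessLib

/-!
# Real multiplication is compatible with a polarization: a polarizable `ℚ`-Hodge structure with an action of a TOTALLY REAL
# number field `K` carries a polarization `⟨·,·⟩₂` with `⟨ax, y⟩₂ = ⟨x, ay⟩₂` (Totaro 2015, Lemma 2.1 — the totally real case;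
# the trace average `⟨x,y⟩₂ = Σ_j a_j⁻¹ ⟨e_j x, e_j y⟩` over a trace-orthogonal basis)

[topic AlgebraicGeometry/Motives]

Layer `Literature/AlgebraicGeometry/Motives`, namespace `Literature.AlgebraicGeometry.Motives.HodgeStructure`; lane
`lit-hodgefound` (Track 2 foundations library), prover seat `lit-hodgefound-p02`, generation 48, self-proposed row g48-#6 of
`run/shared/lean/pub/lit-hodgefound/SKELETON.md`. THEOREMS ONLY: no definition, no instance, no notation, no named fact
(D-0026 net debt `0`). The CM half of the printed lemma («`⟨ax,y⟩₂ = ⟨x, ā y⟩₂`» for a CM field) is the tree's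
`Motives/HodgeStructureCMCompatiblePolarization` (`IsPolarizable.exists_isCompatible`, van Geemen's averaging on Deligne's
eigen-projectors, stated under `[IsCMField E]`); THIS file is the TOTALLY REAL half, by the printed route (an ORTHOGONAL basis for
the trace form, so that the dual basis is `f_j = e_j / a_j` and positivity is termwise). Inputs by name: `WeilTypeCM(Proofs)`
(`EndAction`, `baseChange_apply_mem_piece`, `map_F_le`), `WeilTypePolarization` (`bilinForm_baseChange_add_apply`,
`bilinForm_baseChange_smul_apply`), `NumberTheory/NumberFields/TraceFormTotallyReal` (`trace_sq_pos`: `Tr_{K/ℚ}(z²) > 0`),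
Mathlib `LinearMap.BilinForm.exists_orthogonal_basis`, `Algebra.traceForm_isSymm`.

## The source, verbatim

B. Totaro, *Hodge structures of type `(n,0,…,0,n)`*, IMRN 2015 [Totaro2015HodgeStructuresN00N] (held `paper:arxiv-1402.3666`),
§2 p0005: «**Lemma 2.1.** Let `K` be a number field which is either totally real or a CM field. Let `V` be a `K`-Hodge
structure such that the underlying `ℚ`-Hodge structure is polarizable. Then `V` is polarizable as a `K`-Hodge structure.
*Proof.* We can assume that `V` is pure of some weight `m`. Let `⟨,⟩` be a polarization of `V` as a `ℚ`-Hodge structure. We have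
to produce another polarization `⟨,⟩₂ : V × V → ℚ` such that `⟨ax,y⟩₂ = ⟨x, ā y⟩₂` for all `a` in `K` and `x, y` in `V`. Here `ā`
denotes complex conjugation on `K`, which is the identity if `K` is totally real. For `a, b` in `K`, define `⟨a,b⟩ = tr^K_ℚ(a b̄)`.
This is a positive definite symmetric bilinear form on `K` as a `ℚ`-vector space. […] Let `f₁,…,f_r` be the dual basis for `K`,
meaning that `tr^K_ℚ(e_i f̄_j) = δ_{i,j}` for all `i, j`. […] define `⟨x,y⟩₂ = Σ_{j=1}^r ⟨f_j x, e_j y⟩`. We want to show that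
`⟨ux,y⟩₂ = ⟨x, ū y⟩₂` for all `u` in `K` […] It remains to check that `⟨,⟩₂` is a polarization […] it is clear that `⟨,⟩₂` is
`(-1)^m`-symmetric […] Since the action of `K` on `V` sends each subspace `V^{a,b}` of `V ⊗_ℚ ℂ` into itself, the definition of
`⟨,⟩₂` shows that we have `⟨V^{a,b}, V^{a',b'}⟩₂ = 0` for `a' ≠ m − a`. To prove the positivity property of `⟨,⟩₂`, it is convenient
to choose an orthogonal basis `e₁,…,e_r` for `K` as a `ℚ`-vector space. Then `a_j := ⟨e_j,e_j⟩ ∈ ℚ` is positive, and the dual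
basis for `K` is given by `f_j = e_j/a_j`. So `⟨x,y⟩₂ = Σ_{j=1}^r (1/a_j) ⟨e_j x, e_j y⟩` for `x, y` in `V`. […] It follows that
`i^{a−b}(−1)^{m(m−1)/2}⟨x, x̄⟩₂ > 0` for all nonzero `x ∈ V^{a,b}`».

## What is proved (`A : EndAction H K`, `K` TOTALLY REAL, `b : Basis ι ℚ K` ORTHOGONAL for `Tr_{K/ℚ}(xy)`, `a_j = Tr(b_j²)`;
## the averaged form is written out as `Σ_j a_j⁻¹ • Q.compl₁₂ (ι b_j) (ι b_j)` — no definition is introduced)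

* §1 the field: `trace_basis_mul_self_pos` (`a_j > 0`), `trace_mul_basis_eq_repr_mul` (`Tr(x b_i) = xᵢ a_i`),
  **`eq_sum_trace_mul_div_smul`** (`x = Σ_i (Tr(x b_i)/a_i) b_i` — «the dual basis … is given by `f_j = e_j/a_j`»).
* §2 the average: `rmAverage_apply` (evaluation), **`rmAverage_apply_ι_left`** («`⟨ux,y⟩₂ = ⟨x,uy⟩₂`»), `rmAverage_flip`
  («`(-1)^m`-symmetric»), `rmAverage_baseChange_apply`, `rmAverage_baseChange_apply_eq_zero` (first Riemann condition, termwise),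
  **`rmAverage_pos`** (second Riemann condition: `Σ_j a_j⁻¹ · i^{p−q}⟨e_j x, \overline{e_j x}⟩`, non-negative terms, one positive since
  `x = Σ_j c_j e_j x`).
* §3 **`EndAction.exists_polarization_form_apply_ι`** — TOTARO'S LEMMA 2.1 (totally real case): a polarizable `ℚ`-Hodge structure with
  an action of a totally real field `K` has a polarization `ψ` with `ψ(ι(u)v, w) = ψ(v, ι(u)w)` for all `u ∈ K`
  (`exists_polarization_isAdjointPair_ι_self`: each `ι(u)` is `ψ`-self-adjoint).
* §4 the `E_φ`-level readings through `EndAction.ofRingHom` (`Motives/HodgeStructureEndomorphismFieldCharpoly`):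
  `exists_polarization_form_apply_of_ringHom_endAlg` (any ring map `f : K → E_φ` from a totally real field is self-adjoint for SOME
  polarization) and `exists_polarization_forall_endAlg_form_apply_of_ringEquiv_of_isTotallyReal` (`E_φ ≅ K` totally real ⇒ some
  polarization makes every Hodge endomorphism self-adjoint).

Honest column: only the totally real case; `K`-Hodge structures are read as `EndAction H K` (the tree's notion); «polarizable as a
`K`-Hodge structure» is read as the displayed identity `⟨ax,y⟩₂ = ⟨x,ay⟩₂` of the proof.
-/

noncomputable section

open Module NumberField
open scoped TensorProduct

universe u v

namespace Literature.AlgebraicGeometry.Motives.HodgeStructure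

variable {V : Type u} [AddCommGroup V] [Module ℚ V] {n : ℤ} {H : HodgeStructure V n}
variable {K : Type v} [Field K] [NumberField K]

namespace EndAction

/-! ## §1 A trace-orthogonal basis of a totally real field: `a_j = Tr(e_j²) > 0`, `x = Σ (Tr(x e_j)/a_j) e_j` -/

section Field

variable {ι : Type*} [Fintype ι] (b : Basis ι ℚ K)

omit [Fintype ι] in
/-- `a_j = Tr_{K/ℚ}(e_j e_j) > 0` for a basis vector of a totally real field («`a_j := ⟨e_j,e_j⟩ ∈ ℚ` is positive»).
[cite: Totaro2015HodgeStructuresN00N, §2 proof of Lemma 2.1 (arXiv p0005)] -/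
theorem trace_basis_mul_self_pos [IsTotallyReal K] (j : ι) : 0 < Algebra.trace ℚ K (b j * b j) := by
  rw [← sq]
  exact Literature.NumberTheory.NumberFields.trace_sq_pos (b.ne_zero j)

/-- `Tr(x e_i) = x_i · a_i` in a trace-orthogonal basis. [cite: Totaro2015HodgeStructuresN00N, §2 proof of Lemma 2.1 (arXiv p0005)] -/
theorem trace_mul_basis_eq_repr_mul (hb : (Algebra.traceForm ℚ K).IsOrthoᵢ b) (x : K) (i : ι) :
    Algebra.trace ℚ K (x * b i) = b.repr x i * Algebra.trace ℚ K (b i * b i) := by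
  conv_lhs => rw [← b.sum_repr x]
  rw [Finset.sum_mul, map_sum, Finset.sum_eq_single i]
  · rw [smul_mul_assoc, map_smul, smul_eq_mul]
  · intro j _ hji
    have h0 : Algebra.trace ℚ K (b j * b i) = 0 := hb hji
    rw [smul_mul_assoc, map_smul, smul_eq_mul, h0, mul_zero]
  · intro hi
    exact absurd (Finset.mem_univ i) hi

/-- **«the dual basis … is given by `f_j = e_j/a_j`»: `x = Σ_i (Tr(x e_i)/a_i) e_i`** in a trace-orthogonal basis of a totally real field.
[cite: Totaro2015HodgeStructuresN00N, §2 proof of Lemma 2.1 (arXiv p0005)] -/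
theorem eq_sum_trace_mul_div_smul [IsTotallyReal K] (hb : (Algebra.traceForm ℚ K).IsOrthoᵢ b) (x : K) :
    x = ∑ i, (Algebra.trace ℚ K (x * b i) / Algebra.trace ℚ K (b i * b i)) • b i := by
  conv_lhs => rw [← b.sum_repr x]
  refine Finset.sum_congr rfl fun i _ ↦ ?_
  rw [trace_mul_basis_eq_repr_mul b hb x i, mul_div_cancel_right₀ _ (trace_basis_mul_self_pos b i).ne']

end Field

/-! ## §2 The trace average `⟨x,y⟩₂ = Σ_j a_j⁻¹ ⟨e_j x, e_j y⟩` -/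

section Average

variable (A : EndAction H K) {ι : Type*} [Fintype ι] (b : Basis ι ℚ K)

/-- Evaluation of the average. [cite: Totaro2015HodgeStructuresN00N, §2 proof of Lemma 2.1 (arXiv p0005) «⟨x,y⟩₂ = Σ (1/a_j)⟨e_j x, e_j y⟩»] -/
theorem rmAverage_apply (Q : LinearMap.BilinForm ℚ V) (v w : V) :
    (∑ j, (Algebra.trace ℚ K (b j * b j))⁻¹ • Q.compl₁₂ (A.ι (b j)) (A.ι (b j))) v w =
      ∑ j, (Algebra.trace ℚ K (b j * b j))⁻¹ * Q (A.ι (b j) v) (A.ι (b j) w) := by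
  simp only [LinearMap.sum_apply, LinearMap.smul_apply, LinearMap.compl₁₂_apply, smul_eq_mul]

/-- `ι(e_j)(ι(u) v) = Σ_i (Tr(e_j u e_i)/a_i) ι(e_i) v`. [cite: Totaro2015HodgeStructuresN00N, §2 proof of Lemma 2.1 (arXiv p0005)] -/
theorem ι_basis_ι_apply [IsTotallyReal K] (hb : (Algebra.traceForm ℚ K).IsOrthoᵢ b) (u : K) (j : ι) (v : V) :
    A.ι (b j) (A.ι u v) =
      ∑ i, (Algebra.trace ℚ K (b j * u * b i) / Algebra.trace ℚ K (b i * b i)) • A.ι (b i) v := by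
  rw [← Module.End.mul_apply, ← map_mul]
  conv_lhs => rw [eq_sum_trace_mul_div_smul b hb (b j * u)]
  rw [map_sum, LinearMap.sum_apply]
  refine Finset.sum_congr rfl fun i _ ↦ ?_
  rw [map_smul, LinearMap.smul_apply]

/-- **«`⟨ux, y⟩₂ = ⟨x, uy⟩₂`»: the trace average over an orthogonal basis is `K`-balanced.**
[cite: Totaro2015HodgeStructuresN00N, §2 Lemma 2.1 and proof (arXiv p0005)] -/
theorem rmAverage_apply_ι_left [IsTotallyReal K] (hb : (Algebra.traceForm ℚ K).IsOrthoᵢ b) (Q : LinearMap.BilinForm ℚ V)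
    (u : K) (v w : V) :
    (∑ j, (Algebra.trace ℚ K (b j * b j))⁻¹ • Q.compl₁₂ (A.ι (b j)) (A.ι (b j))) (A.ι u v) w =
      (∑ j, (Algebra.trace ℚ K (b j * b j))⁻¹ • Q.compl₁₂ (A.ι (b j)) (A.ι (b j))) v (A.ι u w) := by
  rw [rmAverage_apply, rmAverage_apply]
  simp_rw [A.ι_basis_ι_apply b hb u, LinearMap.map_sum₂, map_sum, LinearMap.map_smul₂, map_smul, smul_eq_mul,
    Finset.mul_sum]
  conv_rhs => rw [Finset.sum_comm]
  refine Finset.sum_congr rfl fun x _ ↦ Finset.sum_congr rfl fun y _ ↦ ?_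
  have htr : Algebra.trace ℚ K (b x * u * b y) = Algebra.trace ℚ K (b y * u * b x) := congrArg _ (by ring)
  rw [htr]
  ring

/-- `(-1)^n`-symmetry is inherited termwise («it is clear that `⟨,⟩₂` is `(-1)^m`-symmetric»).
[cite: Totaro2015HodgeStructuresN00N, §2 proof of Lemma 2.1 (arXiv p0005)] -/
theorem rmAverage_flip {Q : LinearMap.BilinForm ℚ V} {ε : ℤ} (hQ : Q.flip = ε • Q) :
    (∑ j, (Algebra.trace ℚ K (b j * b j))⁻¹ • Q.compl₁₂ (A.ι (b j)) (A.ι (b j))).flip =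
      ε • ∑ j, (Algebra.trace ℚ K (b j * b j))⁻¹ • Q.compl₁₂ (A.ι (b j)) (A.ι (b j)) := by
  have hQ' : ∀ x y : V, Q x y = ε • Q y x := fun x y ↦ by
    have h := LinearMap.congr_fun₂ hQ y x
    simp only [LinearMap.BilinForm.flip_apply, LinearMap.smul_apply] at h
    exact h
  refine LinearMap.ext fun v ↦ LinearMap.ext fun w ↦ ?_
  rw [LinearMap.flip_apply, LinearMap.smul_apply, LinearMap.smul_apply, rmAverage_apply, rmAverage_apply, Finset.smul_sum]
  refine Finset.sum_congr rfl fun j _ ↦ ?_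
  rw [hQ' (A.ι _ w) (A.ι _ v), mul_smul_comm]

/-- `(Q ∘ (f × g))_ℂ (X, Y) = Q_ℂ(f_ℂ X, g_ℂ Y)` (plumbing). [cite: Totaro2015HodgeStructuresN00N, §2 proof of Lemma 2.1 (arXiv p0005)] -/
private theorem bilinForm_baseChange_compl₁₂_apply' (B : LinearMap.BilinForm ℚ V) (f g : Module.End ℚ V) (X Y : ℂ ⊗[ℚ] V) :
    LinearMap.BilinForm.baseChange ℂ (B.compl₁₂ f g) X Y = B.baseChange ℂ (f.baseChange ℂ X) (g.baseChange ℂ Y) := by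
  induction X using TensorProduct.induction_on with
  | zero => simp only [map_zero, LinearMap.zero_apply]
  | tmul c v =>
    induction Y using TensorProduct.induction_on with
    | zero => simp only [map_zero]
    | tmul d w =>
      rw [LinearMap.baseChange_tmul, LinearMap.baseChange_tmul, LinearMap.BilinForm.baseChange_tmul,
        LinearMap.BilinForm.baseChange_tmul, LinearMap.compl₁₂_apply]
    | add Y₁ Y₂ h₁ h₂ => simp only [map_add, h₁, h₂]
  | add X₁ X₂ h₁ h₂ => simp only [map_add, LinearMap.add_apply, h₁, h₂]

omit [Fintype ι] in
/-- `(Σ_{j∈s} c_j • Q ∘ (ι e_j × ι e_j))_ℂ (X, Y) = Σ_{j∈s} c_j · Q_ℂ((ι e_j)_ℂ X, (ι e_j)_ℂ Y)` (plumbing, by induction on `s`).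
[cite: Totaro2015HodgeStructuresN00N, §2 proof of Lemma 2.1 (arXiv p0005)] -/
private theorem baseChange_sum_smul_compl₁₂_apply [DecidableEq ι] (Q : LinearMap.BilinForm ℚ V) (c : ι → ℚ) (s : Finset ι)
    (X Y : ℂ ⊗[ℚ] V) :
    LinearMap.BilinForm.baseChange ℂ (∑ j ∈ s, c j • Q.compl₁₂ (A.ι (b j)) (A.ι (b j))) X Y =
      ∑ j ∈ s, (c j : ℂ) * Q.baseChange ℂ ((A.ι (b j)).baseChange ℂ X) ((A.ι (b j)).baseChange ℂ Y) := by
  induction s using Finset.induction_on with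
  | empty => rw [Finset.sum_empty, Finset.sum_empty, LinearMap.BilinForm.baseChange_zero, LinearMap.zero_apply, LinearMap.zero_apply]
  | insert j s hj ih =>
    rw [Finset.sum_insert hj, Finset.sum_insert hj, bilinForm_baseChange_add_apply, ih, bilinForm_baseChange_smul_apply,
      bilinForm_baseChange_compl₁₂_apply']

/-- Evaluation of the complexified average. [cite: Totaro2015HodgeStructuresN00N, §2 proof of Lemma 2.1 (arXiv p0005)] -/
theorem rmAverage_baseChange_apply (Q : LinearMap.BilinForm ℚ V) (X Y : ℂ ⊗[ℚ] V) :
    LinearMap.BilinForm.baseChange ℂ (∑ j, (Algebra.trace ℚ K (b j * b j))⁻¹ • Q.compl₁₂ (A.ι (b j)) (A.ι (b j))) X Y =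
      ∑ j, ((Algebra.trace ℚ K (b j * b j))⁻¹ : ℚ) * Q.baseChange ℂ ((A.ι (b j)).baseChange ℂ X) ((A.ι (b j)).baseChange ℂ Y) := by
  classical
  exact A.baseChange_sum_smul_compl₁₂_apply b Q _ Finset.univ X Y

/-- **First Riemann condition** («`⟨V^{a,b}, V^{a',b'}⟩₂ = 0` for `a' ≠ m − a`», since every `ι(e_j)_ℂ` preserves the Hodge filtration).
[cite: Totaro2015HodgeStructuresN00N, §2 proof of Lemma 2.1 (arXiv p0005)] -/
theorem rmAverage_baseChange_apply_eq_zero (Q : Polarization H) (p : ℤ) {X : ℂ ⊗[ℚ] V} (hX : X ∈ H.F p) {Y : ℂ ⊗[ℚ] V}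
    (hY : Y ∈ H.F (n + 1 - p)) :
    LinearMap.BilinForm.baseChange ℂ (∑ j, (Algebra.trace ℚ K (b j * b j))⁻¹ • Q.form.compl₁₂ (A.ι (b j)) (A.ι (b j))) X Y = 0 := by
  rw [rmAverage_baseChange_apply]
  refine Finset.sum_eq_zero fun j _ ↦ ?_
  rw [Q.form_apply_eq_zero p _ (A.map_F_le _ p (Submodule.mem_map_of_mem hX)) _ (A.map_F_le _ _ (Submodule.mem_map_of_mem hY)),
    mul_zero]

/-- **Second Riemann condition** («`i^{a−b}(−1)^{m(m−1)/2}⟨x, x̄⟩₂ > 0` for all nonzero `x ∈ V^{a,b}`»): on `0 ≠ x ∈ V^{p,q}`,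
`i^{p−q}⟨x, x̄⟩₂ = Σ_j a_j⁻¹ · i^{p−q}⟨e_j x, \overline{e_j x}⟩` is a sum of non-negative reals (each `e_j x ∈ V^{p,q}`, `a_j > 0`) with a
positive term (`x = Σ_j c_j · e_j x` for `1 = Σ_j c_j e_j`, so some `e_j x ≠ 0`). [cite: Totaro2015HodgeStructuresN00N, §2 proof of Lemma 2.1 (arXiv p0005)] -/
theorem rmAverage_pos [IsTotallyReal K] (Q : Polarization H) (p q : ℤ) (hpq : p + q = n)
    (x : ℂ ⊗[ℚ] V) (hx : x ∈ H.piece p q) (hx0 : x ≠ 0) :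
    ∃ r : ℝ, 0 < r ∧ Complex.I ^ p * (Complex.I ^ q)⁻¹ *
      LinearMap.BilinForm.baseChange ℂ (∑ j, (Algebra.trace ℚ K (b j * b j))⁻¹ • Q.form.compl₁₂ (A.ι (b j)) (A.ι (b j)))
        x (conj x) = r := by
  classical
  -- termwise positivity: `y_j = (ι e_j)_ℂ x ∈ V^{p,q}`
  have hterm : ∀ j, ∃ r : ℝ, 0 ≤ r ∧ ((A.ι (b j)).baseChange ℂ x ≠ 0 → 0 < r) ∧
      Complex.I ^ p * (Complex.I ^ q)⁻¹ *
        Q.form.baseChange ℂ ((A.ι (b j)).baseChange ℂ x) (conj ((A.ι (b j)).baseChange ℂ x)) = r := by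
    intro j
    by_cases h0 : (A.ι (b j)).baseChange ℂ x = 0
    · refine ⟨0, le_rfl, fun h ↦ absurd h0 h, ?_⟩
      rw [h0, LinearMap.map_zero₂, mul_zero, Complex.ofReal_zero]
    · obtain ⟨r, hr, hQ⟩ := Q.pos p q hpq _ (A.baseChange_apply_mem_piece (b j) hx) h0
      exact ⟨r, hr.le, fun _ ↦ hr, hQ⟩
  choose r hr0 hrpos hreq using hterm
  -- `e ↦ (ι e)_ℂ x` is additive: `(ι (Σ c_i e_i))_ℂ x = Σ c_i • (ι e_i)_ℂ x`
  have hlin : ∀ (s : Finset ι) (c : ι → ℚ),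
      (A.ι (∑ i ∈ s, c i • b i)).baseChange ℂ x = ∑ i ∈ s, c i • (A.ι (b i)).baseChange ℂ x := by
    intro s c
    induction s using Finset.induction_on with
    | empty => rw [Finset.sum_empty, Finset.sum_empty, map_zero, LinearMap.baseChange_zero, LinearMap.zero_apply]
    | insert j s hj ih =>
      rw [Finset.sum_insert hj, Finset.sum_insert hj, map_add, LinearMap.baseChange_add, LinearMap.add_apply, ih, map_smul,
        LinearMap.baseChange_smul, LinearMap.smul_apply]
  -- some `y_j ≠ 0`: `x = (ι 1)_ℂ x = Σ_j c_j • y_j`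
  have hsome : ∃ j, (A.ι (b j)).baseChange ℂ x ≠ 0 := by
    by_contra hall
    have hall' : ∀ j, (A.ι (b j)).baseChange ℂ x = 0 := fun j ↦ not_ne_iff.mp (not_exists.mp hall j)
    apply hx0
    calc x = (A.ι (∑ i, b.repr 1 i • b i)).baseChange ℂ x := by
          rw [b.sum_repr, map_one, LinearMap.baseChange_one, Module.End.one_apply]
      _ = ∑ i, b.repr 1 i • (A.ι (b i)).baseChange ℂ x := hlin _ _
      _ = 0 := Finset.sum_eq_zero fun i _ ↦ by rw [hall' i, smul_zero]
  refine ⟨∑ j, (Algebra.trace ℚ K (b j * b j) : ℝ)⁻¹ * r j, ?_, ?_⟩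
  · obtain ⟨j, hj⟩ := hsome
    exact Finset.sum_pos' (fun i _ ↦ mul_nonneg (inv_nonneg.mpr (by exact_mod_cast (trace_basis_mul_self_pos b i).le)) (hr0 i))
      ⟨j, Finset.mem_univ j, mul_pos (inv_pos.mpr (by exact_mod_cast trace_basis_mul_self_pos b j)) (hrpos j hj)⟩
  · rw [rmAverage_baseChange_apply, Finset.mul_sum, Complex.ofReal_sum]
    refine Finset.sum_congr rfl fun j _ ↦ ?_
    rw [← conj_baseChange, Complex.ofReal_mul, ← hreq j, Complex.ofReal_inv, Complex.ofReal_ratCast, Rat.cast_inv]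
    ring

end Average

/-! ## §3 Totaro's Lemma 2.1 (totally real case) -/

section Existence

/-- **TOTARO'S LEMMA 2.1, TOTALLY REAL CASE.** A polarizable `ℚ`-Hodge structure with an action `ι : K → End(V)` of a TOTALLY REAL
number field `K` by Hodge endomorphisms has a polarization `ψ` for which `K` is self-adjoint: `ψ(ι(u)v, w) = ψ(v, ι(u)w)` («we have
to produce another polarization `⟨,⟩₂` such that `⟨ax,y⟩₂ = ⟨x, ā y⟩₂` … `ā` … is the identity if `K` is totally real»). The CM
case is `IsPolarizable.exists_isCompatible` (`Motives/HodgeStructureCMCompatiblePolarization`).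
[cite: Totaro2015HodgeStructuresN00N, §2 Lemma 2.1 (arXiv p0005)] -/
theorem exists_polarization_form_apply_ι [IsTotallyReal K] (A : EndAction H K) (hpol : H.IsPolarizable) :
    ∃ ψ : Polarization H, ∀ (u : K) (v w : V), ψ.form (A.ι u v) w = ψ.form v (A.ι u w) := by
  classical
  obtain ⟨Q⟩ := hpol
  haveI : Invertible (2 : ℚ) := invertibleOfNonzero two_ne_zero
  obtain ⟨b, hb⟩ := LinearMap.BilinForm.exists_orthogonal_basis (LinearMap.BilinForm.isSymm_iff.1 (Algebra.traceForm_isSymm ℚ (S := K)))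
  exact ⟨{ form := ∑ j, (Algebra.trace ℚ K (b j * b j))⁻¹ • Q.form.compl₁₂ (A.ι (b j)) (A.ι (b j))
           flip_form := A.rmAverage_flip b Q.flip_form
           form_apply_eq_zero := fun p _ hX _ hY ↦ A.rmAverage_baseChange_apply_eq_zero b Q p hX hY
           pos := fun p q hpq x hx hx0 ↦ A.rmAverage_pos b Q p q hpq x hx hx0 },
    fun u v w ↦ A.rmAverage_apply_ι_left b hb Q.form u v w⟩

/-- The same with the polarization as an adjoint pair: `ψ.form.IsAdjointPair ψ.form (ι u) (ι u)` for all `u ∈ K`.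
[cite: Totaro2015HodgeStructuresN00N, §2 Lemma 2.1 (arXiv p0005)] -/
theorem exists_polarization_isAdjointPair_ι_self [IsTotallyReal K] (A : EndAction H K) (hpol : H.IsPolarizable) :
    ∃ ψ : Polarization H, ∀ u : K, LinearMap.IsAdjointPair ψ.form ψ.form (A.ι u) (A.ι u) := by
  obtain ⟨ψ, hψ⟩ := A.exists_polarization_form_apply_ι hpol
  exact ⟨ψ, fun u v w ↦ hψ u v w⟩

end Existence

end EndAction

/-! ## §4 `E_φ`-level readings: a totally real subfield of the endomorphism algebra is self-adjoint for some polarization -/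

section EndAlg

/-- **A TOTALLY REAL FIELD OF HODGE ENDOMORPHISMS IS SELF-ADJOINT FOR SOME POLARIZATION**: for a ring map `f : K → E_φ` from a
totally real number field into the endomorphism algebra of a polarizable `ℚ`-Hodge structure there is a polarization `ψ` with
`ψ(f(u)v, w) = ψ(v, f(u)w)` for all `u ∈ K` (Totaro's Lemma 2.1 through `EndAction.ofRingHom f`).
[cite: Totaro2015HodgeStructuresN00N, §2 Lemma 2.1 (arXiv p0005)] -/
theorem exists_polarization_form_apply_of_ringHom_endAlg [IsTotallyReal K] (f : K →+* H.endAlg) (hpol : H.IsPolarizable) :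
    ∃ ψ : Polarization H, ∀ (u : K) (v w : V),
      ψ.form (((f u : H.endAlg) : Module.End ℚ V) v) w = ψ.form v (((f u : H.endAlg) : Module.End ℚ V) w) :=
  (EndAction.ofRingHom f).exists_polarization_form_apply_ι hpol

/-- **WHEN `E_φ` IS ITSELF A TOTALLY REAL FIELD** (`e : K ≃+* E_φ`, `K` totally real — e.g. the generic member of a family with real
multiplication): some polarization makes EVERY Hodge endomorphism self-adjoint, `ψ(av, w) = ψ(v, aw)` for all `a ∈ E_φ`.
[cite: Totaro2015HodgeStructuresN00N, §2 Lemma 2.1 (arXiv p0005)] -/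
theorem exists_polarization_forall_endAlg_form_apply_of_ringEquiv_of_isTotallyReal [IsTotallyReal K] (e : K ≃+* H.endAlg)
    (hpol : H.IsPolarizable) :
    ∃ ψ : Polarization H, ∀ a : H.endAlg, ∀ v w : V, ψ.form ((a : Module.End ℚ V) v) w = ψ.form v ((a : Module.End ℚ V) w) := by
  obtain ⟨ψ, hψ⟩ := exists_polarization_form_apply_of_ringHom_endAlg (e : K →+* H.endAlg) hpol
  refine ⟨ψ, fun a v w ↦ ?_⟩
  obtain ⟨u, rfl⟩ := e.surjective a
  exact hψ u v w

end EndAlg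

end Literature.AlgebraicGeometry.Motives.HodgeStructure

end
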